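import Summits.CriticalPhenomena.PercolationContinuityZ3.Theorems.PercNearOneGluingNoHeavyLowerTailTwoCopyTables
import Summits.CriticalPhenomena.PercolationContinuityZ3.Theorems.PercNearOneGluingNoHeavyLowerTailTwoCopyRelabel
import Summits.CriticalPhenomena.PercolationContinuityZ3.Theorems.PercNearOneGluingNoHeavyLowerTailOneCutCertAssembly
import HarnessLib

/-!
# `Z(3,2)` (`OneCutFive.ZeroOneThree`) on five vertices by a two-copy certificate: tables, soundness, closedness, assembly

builds on p205010 (kernel theorem, internal audit signed; external expert review pending)

Support file (`--supports stmt-CriticalPhenomena-4575`), seat `prim-cert-1` (gen 9).  QUANT lane rung R8 (`Quant.FarRelayRow`): its first open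
instance is `Z(3,2)` = `OneCutFive.ZeroOneThree` (layer `j = 1`, `|A| = 3`), in the tree for `n ≤ 4` (`ThreePort.zeroOneThree_of_card_le_four`).
This file is the measure-side bookkeeping for the next case `n = 5` (observer, three relays, ONE Steiner vertex), proved in the companion
COMPUTATIONAL file `…QuantZeroOneK5` from an exact two-copy (Bernstein bidegree-2) certificate found by linear programming
(`TwoCopy.twoCopyCheck` of `…TwoCopyFibre`; kit jobs j098050/j098123).  Contents:

* the target / hypothesis TABLES of the `Z(3,2)` family for the generic checker: `tZ3 j c = 1[o ↮ v_j](c) − 1[N(c) ≤ 1]` (`v_j` the `j`-th relay,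
  `N = #{v ∈ R : o ↔ v}`) and `hZ3 c = N(c) − 2`, with their expectations (`ex_tZ3`, `ex_hZ3`, `ex_leOne`);
* `leOne_le_of_check_open` — a passed check (for tables agreeing with `tZ3, hZ3` on the masks `< 2^m`, e.g. memoised copies) with a
  multiplier `a ≢ 0` gives, on the OPEN weight cube, `Σ_v P(o ↔ v) ≥ 2 ∧ (∀ v, P(o ↮ v) ≤ t) ⟹ P(N ≤ 1) ≤ t`;
* `ZO3 w R o` — the `Z(3,2)` property at `(w, R, o)`; transport along vertex permutations (`ZO3.of_relabel`), closedness in the weights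
  (`ZO3.of_limit`, `ZO3.of_generic`, reusing `OneCutCert.nudge`), the trivial case `o ∈ R` (`ZO3.of_mem`);
* `zeroOneThree_fin5_of` — `Z(3,2)` for EVERY `(w, R, o)` on `Fin 5` from the single canonical open-cube statement
  (observer `0`, relays `[1,2,3]`, Steiner vertex `4`).

No sorries; standard axioms; nothing here is computational and nothing asserts `ZeroOneThree` itself.
[cite: KozmaNitzan2024, Lemma 2 (p. 6)] (context: level 1 of the family; `Z(3,2)` is this programme's statement).
-/

namespace Summit.CriticalPhenomena.PercolationContinuityZ3.Theorems.TwoCopy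

open Finset MeasureTheory Filter Topology
open Literature.Probability.Percolation Literature.Probability.LatticeModels
open Summit.CriticalPhenomena.PercolationContinuityZ3.Theorems.AdditiveGluing.Negative.Cert
open scoped Classical

/-! ## Tables of the `Z(3,2)` family -/

/-- Target table: `t_j(c) = 1[o ↮ v_j in c] − 1[N(c) ≤ 1]`, `v_j = As[j]` (junk `o` beyond the list). [this work] -/
def tZ3 (n : ℕ) (es : List (Fin n × Fin n)) (As : List (Fin n)) (o : Fin n) (j c : ℕ) : ℤ :=
  (if connB n es c o (As.getD j o) then 0 else 1) - (if relayCount n es As o c ≤ 1 then 1 else 0)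

/-- Hypothesis table: `h(c) = N(c) − 2`. [this work] -/
def hZ3 (n : ℕ) (es : List (Fin n × Fin n)) (As : List (Fin n)) (o : Fin n) (c : ℕ) : ℤ :=
  (relayCount n es As o c : ℤ) - 2

section Expect

variable {n : ℕ} (w : Sym2 (Fin n) → unitInterval)

/-- `E_w[1[N ≤ 1]] = P_w(N ≤ 1)`. [this work] -/
theorem ex_leOne {As : List (Fin n)} (hAs : As.Nodup) (o : Fin n) :
    ex (mA n) (wA w) (fun c => if relayCount n (allPairs n) As o c ≤ 1 then 1 else 0) =
      (prodBernoulli w).real {ω : Set (Sym2 (Fin n)) | (As.toFinset.filter fun a => ω ∈ openConn o a).card ≤ 1} := by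
  classical
  set D : Set (Set (Sym2 (Fin n))) := {ω | (As.toFinset.filter fun a => ω ∈ openConn o a).card ≤ 1} with hDdef
  have hdet : DeterminedBy D (↑(Eset (allPairs n)) : Set (Sym2 (Fin n))) :=
    determinedBy_allPairs_of_openGraph fun ω ω' h => by
      simp only [hDdef, Set.mem_setOf_eq, openConn, h]
  rw [prodBernoulli_real_eq_ex w (allPairs n) (nodup_map_mkE_allPairs n) D hdet]
  refine sum_congr rfl fun c _ => ?_
  dsimp only
  congr 1
  rw [relayCount_eq_card _ hAs o c]
  simp only [hDdef, Set.mem_setOf_eq]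

/-- `E_w[h] = Σ_{v ∈ R} P_w(o ↔ v) − 2`. [this work] -/
theorem ex_hZ3 {As : List (Fin n)} (hAs : As.Nodup) (o : Fin n) :
    ex (mA n) (wA w) (fun c => (hZ3 n (allPairs n) As o c : ℝ)) =
      (∑ a ∈ As.toFinset, (prodBernoulli w).real (openConn o a)) - 2 := by
  have h2 : ex (mA n) (wA w) (fun _ => (2 : ℝ)) = 2 := by
    have := ex_const_mul (mA n) (wA w) 2 (fun _ => 1)
    simp only [mul_one] at this
    rw [this, ex_one w (allPairs n) (nodup_map_mkE_allPairs n), mul_one]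
  unfold hZ3
  push_cast
  rw [ex_sub, ex_relayCount w hAs o, h2]

/-- `E_w[t_j] = P_w(o ↮ v_j) − P_w(N ≤ 1)`. [this work] -/
theorem ex_tZ3 {As : List (Fin n)} (hAs : As.Nodup) (o : Fin n) (j : ℕ) :
    ex (mA n) (wA w) (fun c => (tZ3 n (allPairs n) As o j c : ℝ)) =
      (prodBernoulli w).real (openConn o (As.getD j o))ᶜ -
      (prodBernoulli w).real {ω : Set (Sym2 (Fin n)) | (As.toFinset.filter fun a => ω ∈ openConn o a).card ≤ 1} := by
  unfold tZ3
  push_cast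
  rw [ex_sub, ex_notConnB w, ex_leOne w hAs o]

end Expect

/-! ## `Z(3,2)` on the open cube from a passed check -/

/-- **`Z(3,2)` on the OPEN cube from a two-copy certificate.**  If the check passes for tables `t', h'` agreeing with
`tZ3, hZ3` below `2^m` (three relays) and a multiplier `a` with a positive entry, then for every weight vector with all pair
weights in `(0,1)`, `Σ_{v∈R} P(o ↔ v) ≥ 2` and all cuts `P(o ↮ v) ≤ t`: `P(N ≤ 1) ≤ t`. [this work] -/
theorem leOne_le_of_check_open {n : ℕ} {As : List (Fin n)} (hAs : As.Nodup) (hlen : As.length = 3) (o : Fin n)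
    {t' : ℕ → ℕ → ℤ} {h' : ℕ → ℤ} {a : ℕ → ℕ → ℕ} {b : ℕ → ℕ}
    (ht' : ∀ j < 3, ∀ c < 2 ^ mA n, t' j c = tZ3 n (allPairs n) As o j c)
    (hh' : ∀ c < 2 ^ mA n, h' c = hZ3 n (allPairs n) As o c)
    (hc : twoCopyCheck (mA n) 3 t' h' a b = true)
    {j₀ c₀ : ℕ} (hj₀ : j₀ < 3) (hc₀ : c₀ < 2 ^ mA n) (ha₀ : 0 < a j₀ c₀)
    (w : Sym2 (Fin n) → unitInterval) (hopen : ∀ i < mA n, 0 < wA w i ∧ wA w i < 1)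
    (hEN : 2 ≤ ∑ x ∈ As.toFinset, (prodBernoulli w).real (openConn o x))
    (t : ℝ) (hcut : ∀ x ∈ As.toFinset, (prodBernoulli w).real (openConn o x)ᶜ ≤ t) :
    (prodBernoulli w).real {ω : Set (Sym2 (Fin n)) | (As.toFinset.filter fun x => ω ∈ openConn o x).card ≤ 1} ≤ t := by
  classical
  set L := (prodBernoulli w).real {ω : Set (Sym2 (Fin n)) | (As.toFinset.filter fun x => ω ∈ openConn o x).card ≤ 1} with hL
  have hw01 : ∀ i, 0 ≤ wA w i ∧ wA w i ≤ 1 := fun i => wN_mem w (allPairs n) i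
  -- the memoised tables have the same expectations
  have hexh : ex (mA n) (wA w) (fun c => (h' c : ℝ)) = ex (mA n) (wA w) (fun c => (hZ3 n (allPairs n) As o c : ℝ)) := by
    unfold ex
    exact sum_congr rfl fun c hc' => by dsimp only; rw [hh' c (mem_range.1 hc')]
  have hext : ∀ j < 3, ex (mA n) (wA w) (fun c => (t' j c : ℝ)) = ex (mA n) (wA w) (fun c => (tZ3 n (allPairs n) As o j c : ℝ)) := by
    intro j hj
    unfold ex
    exact sum_congr rfl fun c hc' => by dsimp only; rw [ht' j hj c (mem_range.1 hc')]
  -- the certificate inequality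
  have hh : 0 ≤ ex (mA n) (wA w) (fun c => (h' c : ℝ)) := by
    rw [hexh, ex_hZ3 w hAs o]; linarith
  have key := sum_ex_mul_ex_nonneg_of_check hc hw01 hh
  -- each target expectation is at most `t − L`
  have hcut' : ∀ j ∈ range 3, ex (mA n) (wA w) (fun c => (t' j c : ℝ)) ≤ t - L := by
    intro j hj
    rw [mem_range] at hj
    rw [hext j hj, ex_tZ3 w hAs o j]
    have hj' : j < As.length := by omega
    have e1 : As.getD j o = As[j] := by
      rw [List.getD_eq_getElem?_getD, List.getElem?_eq_getElem hj', Option.getD_some]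
    have := hcut _ (List.mem_toFinset.2 (e1 ▸ List.getElem_mem hj'))
    linarith
  -- Λ = Σ_j E[a_j] > 0
  have hapos : ∀ j, 0 ≤ ex (mA n) (wA w) (fun c => (a j c : ℝ)) := fun j => ex_nonneg _ hw01 fun c => Nat.cast_nonneg _
  have hΛ : 0 < ∑ j ∈ range 3, ex (mA n) (wA w) (fun c => (a j c : ℝ)) := by
    refine lt_of_lt_of_le ?_ (single_le_sum (fun j _ => hapos j) (mem_range.2 hj₀))
    unfold ex
    refine lt_of_lt_of_le ?_ (single_le_sum (fun c _ => mul_nonneg (Nat.cast_nonneg _) (wt_nonneg _ hw01 c)) (mem_range.2 hc₀))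
    exact mul_pos (by exact_mod_cast ha₀) (wt_pos_of_lt _ hopen c₀)
  -- combine
  have hsum : ∑ j ∈ range 3, ex (mA n) (wA w) (fun c => (t' j c : ℝ)) * ex (mA n) (wA w) (fun c => (a j c : ℝ)) ≤
      ∑ j ∈ range 3, (t - L) * ex (mA n) (wA w) (fun c => (a j c : ℝ)) :=
    sum_le_sum fun j hj => mul_le_mul_of_nonneg_right (hcut' j hj) (hapos j)
  rw [← mul_sum] at hsum
  have h3 : 0 ≤ (t - L) * ∑ j ∈ range 3, ex (mA n) (wA w) (fun c => (a j c : ℝ)) := le_trans key hsum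
  by_contra hlt
  have h4 : (t - L) * ∑ j ∈ range 3, ex (mA n) (wA w) (fun c => (a j c : ℝ)) < 0 :=
    mul_neg_of_neg_of_pos (by linarith) hΛ
  linarith

/-! ## The `Z(3,2)` property: relabelling, closedness, trivial case -/

/-- The `Z(3,2)` property at `(w, R, o)`: `Σ_{v∈R} P(o ↔ v) > 2 → (∀ v ∈ R, P(o ↮ v) ≤ t) → P(#{v ∈ R : o ↔ v} ≤ 1) ≤ t`. [this work] -/
def ZO3 {n : ℕ} (w : Sym2 (Fin n) → unitInterval) (R : Finset (Fin n)) (o : Fin n) : Prop :=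
  2 < ∑ v ∈ R, (prodBernoulli w).real (openConn o v) →
    ∀ t : ℝ, (∀ v ∈ R, (prodBernoulli w).real (openConn o v)ᶜ ≤ t) →
      (prodBernoulli w).real {ω : BondConfig (Fin n) | (R.filter fun v => ω ∈ openConn o v).card ≤ 1} ≤ t

/-- **Relabelling**: `ZO3` for `(w, R, o)` follows from `ZO3` for `(w^σ, σ R, σ o)`. [this work] -/
theorem ZO3.of_relabel {n : ℕ} (σ : Equiv.Perm (Fin n)) (w : Sym2 (Fin n) → unitInterval) (R : Finset (Fin n)) (o : Fin n)
    (h : ZO3 (relabelW σ w) (R.map σ.toEmbedding) (σ o)) : ZO3 w R o := by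
  intro hEN t hcut
  have hcut' : ∀ v ∈ R.map σ.toEmbedding, (prodBernoulli (relabelW σ w)).real (openConn (σ o) v)ᶜ ≤ t := by
    intro v hv
    obtain ⟨x, hx, rfl⟩ := Finset.mem_map.1 hv
    rw [Equiv.toEmbedding_apply, ← real_compl_openConn_relabelW σ w o x]
    exact hcut x hx
  have hmean := sum_openConn_relabelW σ w R o
  have key := h (by rw [hmean]; exact hEN) t hcut'
  have hev : BondConfig.relabel (sym2Equiv σ) ⁻¹' {ω : BondConfig (Fin n) |
        ((R.map σ.toEmbedding).filter fun v => ω ∈ openConn (σ o) v).card ≤ 1} =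
      {ω : BondConfig (Fin n) | (R.filter fun v => ω ∈ openConn o v).card ≤ 1} := by
    ext ω
    simp only [Set.mem_preimage, Set.mem_setOf_eq, card_filter_relabel σ R o ω]
  rw [← hev, real_preimage_relabelW]
  exact key

/-- The event `{N ≤ 1}` is read off the open graph. [folklore] -/
theorem leOne_of_openGraph {n : ℕ} (R : Finset (Fin n)) (o : Fin n) (ω ω' : Set (Sym2 (Fin n)))
    (h : openGraph ω = openGraph ω') :
    (ω ∈ {ω : BondConfig (Fin n) | (R.filter fun v => ω ∈ openConn o v).card ≤ 1}) ↔
    (ω' ∈ {ω : BondConfig (Fin n) | (R.filter fun v => ω ∈ openConn o v).card ≤ 1}) := by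
  have : (R.filter fun v => ω ∈ openConn o v) = R.filter fun v => ω' ∈ openConn o v :=
    Finset.filter_congr fun v _ => OneCutCert.openConn_of_openGraph o v ω ω' h
  simp only [Set.mem_setOf_eq, this]

/-- **Closedness**: if `ZO3 · R o` holds along a sequence of weight vectors converging to `w`, it holds at `w`. [this work] -/
theorem ZO3.of_limit {n : ℕ} (R : Finset (Fin n)) (o : Fin n) (w : Sym2 (Fin n) → unitInterval)
    (u : ℕ → Sym2 (Fin n) → unitInterval) (hu : Tendsto u atTop (𝓝 w)) (h : ∀ᶠ k in atTop, ZO3 (u k) R o) :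
    ZO3 w R o := by
  intro hEN t hcut
  by_cases hne : R.Nonempty
  · set D : (Sym2 (Fin n) → unitInterval) → ℝ := fun v =>
      R.sup' hne fun x => (prodBernoulli v).real (openConn o x)ᶜ with hD
    set L : (Sym2 (Fin n) → unitInterval) → ℝ := fun v => (prodBernoulli v).real {ω : BondConfig (Fin n) |
        (R.filter fun x => ω ∈ openConn o x).card ≤ 1} with hL
    set E : (Sym2 (Fin n) → unitInterval) → ℝ := fun v => ∑ x ∈ R, (prodBernoulli v).real (openConn o x) with hE
    have hDc : Continuous D := Continuous.finset_sup'_apply hne fun x _ =>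
      OneCutCert.continuous_real_of_openGraph _ fun ω ω' h => not_congr (OneCutCert.openConn_of_openGraph o x ω ω' h)
    have hLc : Continuous L := OneCutCert.continuous_real_of_openGraph _ (leOne_of_openGraph R o)
    have hEc : Continuous E := continuous_finsetSum _ fun x _ =>
      OneCutCert.continuous_real_of_openGraph _ (OneCutCert.openConn_of_openGraph o x)
    have hev : ∀ᶠ k in atTop, L (u k) ≤ D (u k) := by
      have h2 : ∀ᶠ k in atTop, 2 < E (u k) :=
        (hEc.tendsto w).comp hu |>.eventually (lt_mem_nhds hEN)
      refine (h2.and h).mono fun k hk => ?_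
      exact hk.2 hk.1 (D (u k)) fun x hx =>
        Finset.le_sup' (fun x : Fin n => (prodBernoulli (u k)).real (openConn o x)ᶜ) hx
    have hlim : L w ≤ D w :=
      le_of_tendsto_of_tendsto ((hLc.tendsto w).comp hu) ((hDc.tendsto w).comp hu) hev
    exact hlim.trans (Finset.sup'_le hne _ fun x hx => hcut x hx)
  · exfalso
    rw [Finset.not_nonempty_iff_eq_empty] at hne
    rw [hne, Finset.sum_empty] at hEN
    linarith

/-- **Generic weights suffice**: if `ZO3 · R o` holds for every generic weight vector then it holds for all. [this work] -/
theorem ZO3.of_generic {n : ℕ} (R : Finset (Fin n)) (o : Fin n)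
    (h : ∀ w : Sym2 (Fin n) → unitInterval, OneCutCert.Generic w → ZO3 w R o) (w : Sym2 (Fin n) → unitInterval) :
    ZO3 w R o := by
  refine ZO3.of_limit R o w (fun k e => OneCutCert.nudge k (w e))
    (tendsto_pi_nhds.2 fun e => OneCutCert.nudge_tendsto (w e)) ?_
  have hall : ∀ᶠ k in atTop, ∀ e : Sym2 (Fin n),
      ((OneCutCert.nudge k (w e) : ℝ) ≠ 0 ∧ (OneCutCert.nudge k (w e) : ℝ) ≠ 1 / 2 ∧ (OneCutCert.nudge k (w e) : ℝ) ≠ 1) :=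
    Filter.eventually_all.2 fun e => OneCutCert.nudge_eventually_generic (w e)
  exact hall.mono fun k hk => h _ fun e _ => hk e

/-- **Trivial case `o ∈ R`** (`|R| ≥ 2`): `o` reaches itself, so `{N ≤ 1} ⊆ {o ↮ v}` for any other `v ∈ R`. [this work] -/
theorem ZO3.of_mem {n : ℕ} (w : Sym2 (Fin n) → unitInterval) (R : Finset (Fin n)) (o : Fin n) (hoR : o ∈ R)
    (hR : 1 < R.card) : ZO3 w R o := by
  intro _ t hcut
  obtain ⟨v, hvR, hvo⟩ := Finset.exists_mem_ne hR o
  have hsub : {ω : BondConfig (Fin n) | (R.filter fun v => ω ∈ openConn o v).card ≤ 1} ⊆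
      (openConn o v : Set (BondConfig (Fin n)))ᶜ := by
    intro ω hω hωv
    have hoF : o ∈ R.filter fun u => ω ∈ openConn o u :=
      Finset.mem_filter.2 ⟨hoR, (SimpleGraph.Reachable.refl o : (openGraph ω).Reachable o o)⟩
    have hvF : v ∈ R.filter fun u => ω ∈ openConn o u := Finset.mem_filter.2 ⟨hvR, hωv⟩
    have h2 : 1 < (R.filter fun u => ω ∈ openConn o u).card := Finset.one_lt_card.2 ⟨v, hvF, o, hoF, hvo⟩
    have h1 : (R.filter fun u => ω ∈ openConn o u).card ≤ 1 := hω
    omega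
  exact (measureReal_mono hsub (measure_ne_top _ _)).trans (hcut v hvR)

/-! ## Generic weights are in the open cube of the coordinates -/

/-- For a generic weight vector every coordinate along `allPairs n` lies in `(0, 1)`. [this work] -/
theorem open_of_generic {n : ℕ} (w : Sym2 (Fin n) → unitInterval) (hg : OneCutCert.Generic w) :
    ∀ i < mA n, 0 < wA w i ∧ wA w i < 1 := by
  intro i hi
  have hw : wA w i = (w (mkE ((allPairs n)[i])) : ℝ) := by
    show wN w (allPairs n) i = _
    unfold wN
    rw [dif_pos hi]
  have hnd : ¬ (mkE ((allPairs n)[i])).IsDiag := by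
    have hmem : (allPairs n)[i] ∈ allPairs n := List.getElem_mem hi
    rw [mem_allPairs] at hmem
    unfold mkE
    rw [Sym2.mk_isDiag_iff]
    exact ne_of_lt hmem
  obtain ⟨h0, -, h1⟩ := hg _ hnd
  have hm := (w (mkE ((allPairs n)[i]))).2
  rw [hw]
  exact ⟨lt_of_le_of_ne hm.1 (Ne.symm h0), lt_of_le_of_ne hm.2 h1⟩

/-! ## Assembly on five vertices -/

/-- Canonical relay list on `Fin 5`: `[1, 2, 3]` (observer `0`, Steiner vertex `4`). [this work] -/
def As5 : List (Fin 5) := [1, 2, 3]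

/-- `As5` enumerates `univ ∖ {0, 4}`. [this work] -/
theorem toFinset_As5 : As5.toFinset = ((Finset.univ : Finset (Fin 5)).erase 4).erase 0 := by decide

/-- `As5` has no duplicates. [this work] -/
theorem nodup_As5 : As5.Nodup := by decide

/-- A permutation of `Fin 5` sending `o ↦ 0` and `f ↦ 4` (`o ≠ f`). [this work] -/
theorem exists_perm_zero_four (o f : Fin 5) (hof : o ≠ f) : ∃ σ : Equiv.Perm (Fin 5), σ o = 0 ∧ σ f = 4 := by
  refine ⟨(Equiv.swap o 0).trans (Equiv.swap (Equiv.swap o 0 f) 4), ?_, ?_⟩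
  · rw [Equiv.trans_apply, Equiv.swap_apply_left]
    apply Equiv.swap_apply_of_ne_of_ne
    · intro h
      apply hof
      have h1 : Equiv.swap o 0 o = Equiv.swap o 0 f := by rw [Equiv.swap_apply_left]; exact h
      exact (Equiv.swap o 0).injective h1
    · decide
  · rw [Equiv.trans_apply, Equiv.swap_apply_left]

/-- **Assembly.**  `Z(3,2)` for every `(w, R, o)` on `Fin 5` (`|R| = 3`) from the CANONICAL OPEN-CUBE statement (observer `0`,
relays `As5 = [1,2,3]`, Steiner vertex `4`, all ten pair weights in `(0,1)`, `Σ_v P(0 ↔ v) ≥ 2`; discharged computationally in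
`…QuantZeroOneK5`): the case `o ∈ R` is trivial (`ZO3.of_mem`); otherwise `R ∪ {o}` misses exactly one vertex `f`, a permutation
with `o ↦ 0`, `f ↦ 4` maps `R` onto `{1,2,3}` (`ZO3.of_relabel`), and the boundary of the weight cube is reached by density
(`ZO3.of_generic`). [this work] -/
theorem zeroOneThree_fin5_of
    (hcan : ∀ w : Sym2 (Fin 5) → unitInterval, (∀ i < mA 5, 0 < wA w i ∧ wA w i < 1) →
      2 ≤ (∑ x ∈ As5.toFinset, (prodBernoulli w).real (openConn (0 : Fin 5) x)) → ∀ t : ℝ,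
      (∀ x ∈ As5.toFinset, (prodBernoulli w).real (openConn (0 : Fin 5) x)ᶜ ≤ t) →
      (prodBernoulli w).real {ω : Set (Sym2 (Fin 5)) |
        (As5.toFinset.filter fun x => ω ∈ openConn (0 : Fin 5) x).card ≤ 1} ≤ t)
    (w : Sym2 (Fin 5) → unitInterval) (R : Finset (Fin 5)) (o : Fin 5) (hR3 : R.card = 3) : ZO3 w R o := by
  by_cases hoR : o ∈ R
  · exact ZO3.of_mem w R o hoR (by omega)
  -- the vertex outside `R ∪ {o}`
  have hcardI : (insert o R).card = 4 := by rw [Finset.card_insert_of_notMem hoR, hR3]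
  have hAc : (insert o R)ᶜ.card = 1 := by rw [Finset.card_compl, hcardI]; simp
  obtain ⟨f, hf⟩ := Finset.card_eq_one.1 hAc
  have hfI : f ∉ insert o R := by
    have : f ∈ (insert o R)ᶜ := by rw [hf]; exact Finset.mem_singleton_self f
    exact Finset.mem_compl.1 this
  have hof : o ≠ f := fun h => hfI (h ▸ Finset.mem_insert_self o R)
  have hR : R = ((Finset.univ : Finset (Fin 5)).erase f).erase o := by
    ext x
    rw [Finset.mem_erase, Finset.mem_erase]
    constructor
    · intro hx
      refine ⟨fun h => hoR (h ▸ hx), fun h => hfI (h ▸ Finset.mem_insert_of_mem hx), Finset.mem_univ x⟩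
    · rintro ⟨hxo, hxf, -⟩
      have hx : x ∈ insert o R := by
        by_contra hx
        have : x ∈ (insert o R)ᶜ := Finset.mem_compl.2 hx
        rw [hf, Finset.mem_singleton] at this
        exact hxf this
      rcases Finset.mem_insert.1 hx with h | h
      · exact absurd h hxo
      · exact h
  obtain ⟨σ, hσo, hσf⟩ := exists_perm_zero_four o f hof
  have hRm : R.map σ.toEmbedding = As5.toFinset := by
    rw [hR, Finset.map_erase, Finset.map_erase, Finset.map_univ_equiv, toFinset_As5, Equiv.toEmbedding_apply,
      Equiv.toEmbedding_apply, hσo, hσf]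
  -- generic weights: relabel to the canonical position, where the weights are still generic
  refine ZO3.of_generic R o (fun w' hg => ?_) w
  refine ZO3.of_relabel σ w' R o ?_
  rw [hRm, hσo]
  intro hEN t hcut
  have hg' : OneCutCert.Generic (relabelW σ w') := by
    intro e he
    have hnd : ¬ ((sym2Equiv σ).symm e).IsDiag := by
      intro hd
      apply he
      induction e using Sym2.ind with
      | h x y =>
        have h1 : (sym2Equiv σ).symm s(x, y) = s(σ.symm x, σ.symm y) := rfl
        rw [h1, Sym2.mk_isDiag_iff] at hd
        rw [Sym2.mk_isDiag_iff]
        exact σ.symm.injective hd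
    exact hg ((sym2Equiv σ).symm e) hnd
  exact hcan (relabelW σ w') (open_of_generic _ hg') (le_of_lt hEN) t hcut

end Summit.CriticalPhenomena.PercolationContinuityZ3.Theorems.TwoCopy

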